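import Mathlib.Logic.Equiv.Fintype
import Literature.AnabelianGeometry.SemiGraphs.SemiGraph

/-!
# Sheet data of an immersion of finite semi-graphs (for [SemiAnbd] Theorem 1.2)

Mochizuki, *Semi-graphs of anabelioids*, Publ. RIMS **42** (2006) 221–322, §1, Theorem 1.2
("Zariski's main theorem for semi-graphs", proof by M. Matsumoto), author's manuscript pp. 15–18
[cite: MochizukiSemiAnbd2006, Thm. 1.2 p.15].  The printed proof realises an immersion `φ : A → B` of
finite graphs inside a finite graph-covering of `B` by colouring (`B → H_n`, Lemma 1.4), completing
(`A ↪ A' → H_n`, Lemma 1.5) and pulling back.  Unwinding what this produces: a finite graph-covering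
of `B` is a family of finite "sheets" permuted along the branches of `B`, and `A` sits inside it by
assigning a sheet to every vertex and every edge.  This file isolates that combinatorial content in a
form valid for arbitrary finite SEMI-graphs (so that the compactification detour (a), (b) of p. 16 is
not needed): for an immersion `φ : A → B` with `A` finite there are a number `d` of sheets, sheet
labels `α` (vertices) and `β` (edges) of `A`, injective and with disjoint images, and for every branch
`b` of `B` a permutation `σ_b` of the sheets such that following the branch `φ(c)` from the sheet of
the edge of `c` leads to the sheet of the vertex `c` abuts to — and back to the edge's own sheet when
`c` abuts to no vertex (`SemiGraph.exists_immersionSheets`).  Theorem 1.2 (i), (ii) are deduced from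
it in `ZariskiMainTheoremFactorization.lean`, `ZariskiMainTheoremBaseChange.lean`.  Proof-only (no
definitions).
-/

namespace Literature.AnabelianGeometry.SemiGraphs

namespace SemiGraph

open CategoryTheory

universe u

/-- **Sheet data of an immersion** (combinatorial core of [SemiAnbd] Theorem 1.2, pp. 15–18): for an
immersion `φ : A → B` of semi-graphs with `A` finite there exist `d : ℕ`, injective sheet labels
`α : 𝒱_A → Fin d`, `β : ℰ_A → Fin d` with disjoint images, and permutations `σ_b` of `Fin d` indexed by
the branches of `B`, such that `σ_{φ(c)} (β e) = α v` whenever the branch `c` of the edge `e` of `A`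
abuts to `v`, and `σ_{φ(c)} (β e) = β e` whenever `c` abuts to no vertex.  (Each `σ_b` extends the
partial injection so prescribed — injective because `φ` is an immersion — to a permutation.)
[cite: MochizukiSemiAnbd2006, Thm. 1.2 p.15] -/
theorem exists_immersionSheets {A B : SemiGraph.{u}} (φ : A ⟶ B) (hA : A.IsFinite)
    (hφ : IsImmersion φ) :
    ∃ (d : ℕ) (α : A.Vertex → Fin d) (β : A.Edge → Fin d) (σ : B.Branch → Equiv.Perm (Fin d)),
      Function.Injective α ∧ Function.Injective β ∧ (∀ v e, α v ≠ β e) ∧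
      (∀ (c : A.Branch) (v : A.Vertex), A.abuts c = some v →
        σ (φ.branchMap c) (β (A.edgeOf c)) = α v) ∧
      (∀ c : A.Branch, A.abuts c = none → σ (φ.branchMap c) (β (A.edgeOf c)) = β (A.edgeOf c)) := by
  classical
  haveI := hA.finite_vertex
  haveI := hA.finite_edge
  obtain ⟨p, ⟨eV⟩⟩ := Finite.exists_equiv_fin A.Vertex
  obtain ⟨q, ⟨eE⟩⟩ := Finite.exists_equiv_fin A.Edge
  -- sheet labels: vertices in the lower block, edges in the upper block of `Fin (p + q)`
  let α : A.Vertex → Fin (p + q) := fun v => Fin.castAdd q (eV v)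
  let β : A.Edge → Fin (p + q) := fun e => Fin.natAdd p (eE e)
  have hα : Function.Injective α := fun v₁ v₂ h =>
    eV.injective (Fin.castAdd_injective _ _ h)
  have hβ : Function.Injective β := fun e₁ e₂ h =>
    eE.injective (Fin.natAdd_injective _ _ h)
  have hαβ : ∀ v e, α v ≠ β e := fun v e h => by
    have h' := congrArg Fin.val h
    simp only [α, β, Fin.val_castAdd, Fin.val_natAdd] at h'
    have := (eV v).2
    omega
  -- the prescribed value at the sheet of the edge of a branch `c`
  let val : A.Branch → Fin (p + q) := fun c => (A.abuts c).elim (β (A.edgeOf c)) α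
  -- a branch is determined by its image in `B` together with its edge
  have huniq : ∀ c₁ c₂ : A.Branch, φ.branchMap c₁ = φ.branchMap c₂ →
      β (A.edgeOf c₁) = β (A.edgeOf c₂) → c₁ = c₂ :=
    fun c₁ c₂ h hk => φ.branchMap_injOn c₁ c₂ (hβ hk) h
  -- the partial function "sheet of the edge of `c` ↦ prescribed value", for branches over `b₀`
  let P : B.Branch → Fin (p + q) → Prop := fun b₀ k =>
    ∃ c : A.Branch, φ.branchMap c = b₀ ∧ β (A.edgeOf c) = k
  let g : ∀ b₀, {k // P b₀ k} → Fin (p + q) := fun _ k => val (Classical.choose k.2)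
  -- it is injective (this is where `φ` being an immersion enters)
  have hg : ∀ b₀, Function.Injective (g b₀) := by
    intro b₀ k₁ k₂ h
    change val (Classical.choose k₁.2) = val (Classical.choose k₂.2) at h
    have hc₁ := Classical.choose_spec k₁.2
    have hc₂ := Classical.choose_spec k₂.2
    generalize Classical.choose k₁.2 = c₁ at hc₁ h
    generalize Classical.choose k₂.2 = c₂ at hc₂ h
    change (A.abuts c₁).elim (β (A.edgeOf c₁)) α = (A.abuts c₂).elim (β (A.edgeOf c₂)) α at h
    apply Subtype.ext
    rw [← hc₁.2, ← hc₂.2]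
    cases h₁ : A.abuts c₁ with
    | none =>
      cases h₂ : A.abuts c₂ with
      | none =>
        rw [h₁, h₂] at h
        exact congrArg (fun c => β (A.edgeOf c)) (huniq c₁ c₂ (hc₁.1.trans hc₂.1.symm) h)
      | some v₂ =>
        rw [h₁, h₂] at h
        exact absurd h.symm (hαβ v₂ _)
    | some v₁ =>
      cases h₂ : A.abuts c₂ with
      | none =>
        rw [h₁, h₂] at h
        exact absurd h (hαβ v₁ _)
      | some v₂ =>
        rw [h₁, h₂] at h
        change α v₁ = α v₂ at h
        cases hα h
        have := hφ v₁ (a₁ := ⟨c₁, h₁⟩) (a₂ := ⟨c₂, h₂⟩) (Subtype.ext (hc₁.1.trans hc₂.1.symm))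
        exact congrArg (fun c : A.Star v₁ => β (A.edgeOf c.1)) this
  -- extend each partial injection to a permutation of the sheets
  let σ : B.Branch → Equiv.Perm (Fin (p + q)) := fun b₀ =>
    (Equiv.ofInjective (g b₀) (hg b₀)).extendSubtype
  have hσ : ∀ c : A.Branch, σ (φ.branchMap c) (β (A.edgeOf c)) = val c := by
    intro c
    have hP : P (φ.branchMap c) (β (A.edgeOf c)) := ⟨c, rfl, rfl⟩
    change (Equiv.ofInjective (g _) (hg _)).extendSubtype _ = _
    rw [Equiv.extendSubtype_apply_of_mem _ _ hP, Equiv.ofInjective_apply]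
    change val (Classical.choose hP) = val c
    have hc := Classical.choose_spec hP
    rw [huniq _ c hc.1 hc.2]
  refine ⟨p + q, α, β, σ, hα, hβ, hαβ, fun c v h => ?_, fun c h => ?_⟩
  · rw [hσ c]
    change (A.abuts c).elim (β (A.edgeOf c)) α = α v
    rw [h]
    rfl
  · rw [hσ c]
    change (A.abuts c).elim (β (A.edgeOf c)) α = β (A.edgeOf c)
    rw [h]
    rfl

end SemiGraph

end Literature.AnabelianGeometry.SemiGraphs
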